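import Summits.CriticalPhenomena.CardyFormulaZ2.Theses.CardyGluingRDE
import Summits.CriticalPhenomena.CardyFormulaZ2.Theorems.RectilinearCardy.Negative.RectilinearCardySquareInstance
import Literature.Probability.Percolation.CardyFormulaConformalInvariance
import Literature.Probability.Percolation.QuadCrossingSquareModel
import Literature.Probability.Percolation.ZdNearCriticalWindow
import Literature.Probability.Percolation.SiteConnectionTools
import Literature.Probability.LatticeModels.TriangularLatticeProofs
import Literature.Probability.RandomPlanarGeometry.ModulusSymmetry
import Literature.Probability.RandomPlanarGeometry.ConformalRectangleProofs

/-!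
# `CardyGluingRDE.BoxMerging` proves Cardy's formula for the square on `ℤ²` (stmt-CriticalPhenomena-8582)

Item `BoxMerging` of route `CardyGluingRDE` (sub-problem `CardyFormulaZ2`) asks that, for every
side `δ₀ > 0` and every dyadic resolution `j`, the bond-`ℤ²` (mesh `u`) and site-`𝕋` (mesh `u'`)
laws of the Boolean matrix "segment `a` is joined to segment `b` inside the square `(0, δ₀)²`"
(`4·2^j` dyadic boundary segments, G02 events `discreteCrossing` / `triCrossing`) are `ε`-close in
total variation for all small `u, u'`.  Stand-alone this is the universality of the JOINT
boundary-segment laws (Schramm–Smirnov 2011, Question 2 / Conj. 1.2; open); inside the route it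
is the output of the crux `GluingContraction` (`BoxMerging_of_GluingContraction`, tree) and the
input of `MergingGivesPolygonCardy`.

This file turns the informal gloss of the item ("implies LimitExists for every dyadic-marked
square on `ℤ²` since the `𝕋` side converges") into theorems, at resolution `j = 0`:

* `BoxMerging_abs_measureReal_biUnion_sub_le` — TV-Lipschitz transfer: two finite partitions
  `E, F` of two probability spaces indexed by the same finite state space; the probabilities of
  "the state lies in `s`" differ by at most `Σ_i |μ(E i) - ν(F i)|` (= twice the total variation
  of the two state laws).
* `BoxMerging_biUnion_stateEvent`, `BoxMerging_pairwise_disjoint_stateEvent`,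
  `BoxMerging_measurableSet_stateEvent` — the events `{ω | ∀ a b, ω ∈ C a b ↔ M a b}` ("the
  connectivity matrix read from `ω` is `M`", the `EZ`/`ET` of the route) partition the
  configuration space, and each crossing event `C a₀ b₀` is the union of those with `M a₀ b₀`.
* `BoxMerging_abs_bond_sub_tri_le` — hence, for ANY finite family of boundary pieces `A` of a
  bounded window `Ω` and any two pieces `a₀, b₀`:
  `|P_ℤ²[discreteCrossing Ω u (A a₀) (A b₀)] - P_𝕋[triCrossing Ω u' (A a₀) (A b₀)]`
  `≤ Σ_M |P_ℤ²[E_Z(M)] - P_𝕋[E_T(M)]|` (the single-window case of step (iii) of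
  `MergingGivesPolygonCardy`, at every resolution).
* `BoxMerging_hasCrossingLimit_square` — **`BoxMerging` ⇒ Cardy's formula for bond percolation
  on `ℤ²` at `p = 1/2` in the square `(0, δ₀)²` with its four corners marked** (the tree's
  `rectQuad 0 δ₀ 0 δ₀`, arcs = sides): the `j = 0` laws merge, the bottom–top crossing of the
  square is read from the state, and Smirnov's theorem on `𝕋`
  (`hasCrossingLimit_triDomainCrossingProb_holds`, proved in the tree) identifies the limit.
* `BoxMerging_tendsto_half_square` — in particular `P_{1/2}[bottom ↔ top in ((0,δ₀)²)_u] → 1/2`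
  as `u → 0⁺` (the square has modulus `1/2` by the diagonal reflection,
  `crossRatio_eq_half_of_antiAffine`; `F(1/2) = 1/2`).  Neither conclusion is proved in the tree
  for bond-`ℤ²` (they are instances of the conjunct `CardyFormulaZ2`); this is the precise sense
  in which the node `BoxMerging` already contains open instances of the summit statement.
-/

noncomputable section

namespace Summit.CriticalPhenomena.CardyFormulaZ2.Theorems

open scoped BigOperators Topology
open Filter Set MeasureTheory
open Literature.Probability.Percolation Literature.Probability.RandomPlanarGeometry
  Literature.Probability.LatticeModels
open Summit.CriticalPhenomena.CardyFormulaZ2.Theses.CardyGluingRDE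

/-! ### Events read through a finite state -/

section StateEvents

variable {Ω κ : Type*}

/-- The state events `{ω | ∀ a b, ω ∈ C a b ↔ M a b}` ("the matrix read from `ω` is `M`") for
two distinct matrices are disjoint. [folklore] -/
theorem BoxMerging_pairwise_disjoint_stateEvent (C : κ → κ → Set Ω) :
    Pairwise (Function.onFun Disjoint fun M : κ → κ → Bool => {ω | ∀ a b, ω ∈ C a b ↔ M a b = true}) := by
  intro M M' hne
  rw [Function.onFun, Set.disjoint_left]
  intro ω h h'
  exact hne (funext fun a => funext fun b => Bool.eq_iff_iff.2 ((h a b).symm.trans (h' a b)))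

/-- The event `C a₀ b₀` is the union of the state events over the matrices `M` with
`M a₀ b₀ = true` (every `ω` reads exactly one matrix). [folklore] -/
theorem BoxMerging_biUnion_stateEvent [Fintype κ] [DecidableEq κ] (C : κ → κ → Set Ω) (a₀ b₀ : κ) :
    (⋃ M ∈ (Finset.univ.filter fun M : κ → κ → Bool => M a₀ b₀ = true),
      {ω | ∀ a b, ω ∈ C a b ↔ M a b = true}) = C a₀ b₀ := by
  classical
  ext ω
  simp only [mem_iUnion, Finset.mem_filter, Finset.mem_univ, true_and, mem_setOf_eq, exists_prop]
  constructor
  · rintro ⟨M, hM, h⟩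
    exact (h a₀ b₀).2 hM
  · intro hω
    exact ⟨fun a b => decide (ω ∈ C a b), decide_eq_true hω, fun a b => by simp⟩

/-- State events are measurable as soon as the events `C a b` are (finite intersections of
`C a b` / `(C a b)ᶜ`). [folklore] -/
theorem BoxMerging_measurableSet_stateEvent [MeasurableSpace Ω] [Countable κ] (C : κ → κ → Set Ω)
    (hC : ∀ a b, MeasurableSet (C a b)) (M : κ → κ → Bool) :
    MeasurableSet {ω | ∀ a b, ω ∈ C a b ↔ M a b = true} := by
  have e : {ω | ∀ a b, ω ∈ C a b ↔ M a b = true} = ⋂ a, ⋂ b, {ω | ω ∈ C a b ↔ M a b = true} := by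
    ext ω; simp only [mem_setOf_eq, mem_iInter]
  rw [e]
  refine MeasurableSet.iInter fun a => MeasurableSet.iInter fun b => ?_
  by_cases h : M a b = true
  · have e' : {ω | ω ∈ C a b ↔ M a b = true} = C a b := by ext ω; simp [h]
    rw [e']; exact hC a b
  · have e' : {ω | ω ∈ C a b ↔ M a b = true} = (C a b)ᶜ := by ext ω; simp [h]
    rw [e']; exact (hC a b).compl

end StateEvents

/-- **TV-Lipschitz transfer of events read through a finite state.** For two finite measures and
two families of pairwise disjoint measurable events `E`, `F` indexed by the same finite type, the
measures of `⋃_{i ∈ s} E i` and `⋃_{i ∈ s} F i` differ by at most `Σ_i |μ(E i) - ν(F i)|`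
(additivity and the triangle inequality). [folklore] -/
theorem BoxMerging_abs_measureReal_biUnion_sub_le {α β ι : Type*} [MeasurableSpace α]
    [MeasurableSpace β] [Fintype ι] (μ : Measure α) (ν : Measure β) [IsFiniteMeasure μ]
    [IsFiniteMeasure ν] {E : ι → Set α} {F : ι → Set β} (hE : Pairwise (Function.onFun Disjoint E))
    (hF : Pairwise (Function.onFun Disjoint F)) (hEm : ∀ i, MeasurableSet (E i))
    (hFm : ∀ i, MeasurableSet (F i)) (s : Finset ι) :
    |μ.real (⋃ i ∈ s, E i) - ν.real (⋃ i ∈ s, F i)| ≤ ∑ i, |μ.real (E i) - ν.real (F i)| := by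
  rw [measureReal_biUnion_finset (hE.set_pairwise _) (fun i _ => hEm i),
    measureReal_biUnion_finset (hF.set_pairwise _) (fun i _ => hFm i), ← Finset.sum_sub_distrib]
  exact (Finset.abs_sum_le_sum_abs _ _).trans
    (Finset.sum_le_univ_sum_of_nonneg fun i => abs_nonneg _)

/-! ### The two lattices -/

/-- The G02 crossing event of site percolation on `δ𝕋` in a bounded window is measurable
(`δ > 0`: the discrete domain is finite, `triMeshDomain_finite_holds`). [folklore] -/
theorem BoxMerging_measurableSet_triCrossing {Ω : Set ℂ} (hΩ : Bornology.IsBounded Ω) {δ : ℝ}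
    (hδ : 0 < δ) (A B : Set ℂ) : MeasurableSet (triCrossing Ω δ A B) := by
  have hfin : (triMeshDomain Ω δ).Finite := triMeshDomain_finite_holds hΩ hδ
  have heq : triCrossing Ω δ A B =
      ⋃ x ∈ triDiscreteArc Ω δ A, ⋃ y ∈ triDiscreteArc Ω δ B,
        siteConnIn (triDiscreteDomainGraph Ω δ) (↑hfin.toFinset) x y := by
    ext ω
    simp only [triCrossing, mem_setOf_eq, mem_iUnion, exists_prop, Finite.coe_toFinset]
  rw [heq]
  exact MeasurableSet.biUnion (to_countable _) fun x _ =>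
    MeasurableSet.biUnion (to_countable _) fun y _ => measurableSet_siteConnIn _ _ x y

/-- **Crossing probabilities are read from the state law, on both lattices.** For a bounded
window `Ω`, a finite family `A` of boundary pieces, two pieces `a₀, b₀`, a `ℤ²`-mesh `u` and a
`𝕋`-mesh `u' > 0`:
`|P_ℤ²[A a₀ ↔ A b₀ in Ω_u] - P_𝕋[A a₀ ↔ A b₀ in Ω_u']| ≤ Σ_M |P_ℤ²[E_Z(M)] - P_𝕋[E_T(M)]|`, where
`E_Z(M) = {ω | ∀ a b, discreteCrossing Ω u (A a) (A b) ↔ M a b}` and `E_T(M)` likewise with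
`triCrossing` — the right-hand side is twice the total variation between the two laws of the
connectivity matrix (the route's `TV_j`, up to the factor `½`). [folklore] -/
theorem BoxMerging_abs_bond_sub_tri_le {Ω : Set ℂ} (hΩ : Bornology.IsBounded Ω) {κ : Type*}
    [Fintype κ] [DecidableEq κ] (A : κ → Set ℂ) (a₀ b₀ : κ) (u : ℝ) {u' : ℝ} (hu' : 0 < u') :
    |(bondPercolation (zdGraph 2) half).real (discreteCrossing Ω u (A a₀) (A b₀)) -
        (triSitePercolation half).real (triCrossing Ω u' (A a₀) (A b₀))| ≤
      ∑ M : κ → κ → Bool,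
        |(bondPercolation (zdGraph 2) half).real
            {ω | ∀ a b, ω ∈ discreteCrossing Ω u (A a) (A b) ↔ M a b = true} -
          (triSitePercolation half).real
            {ω | ∀ a b, ω ∈ triCrossing Ω u' (A a) (A b) ↔ M a b = true}| := by
  have e1 : discreteCrossing Ω u (A a₀) (A b₀) =
      ⋃ M ∈ (Finset.univ.filter fun M : κ → κ → Bool => M a₀ b₀ = true),
        {ω | ∀ a b, ω ∈ discreteCrossing Ω u (A a) (A b) ↔ M a b = true} :=
    (BoxMerging_biUnion_stateEvent (fun a b => discreteCrossing Ω u (A a) (A b)) a₀ b₀).symm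
  have e2 : triCrossing Ω u' (A a₀) (A b₀) =
      ⋃ M ∈ (Finset.univ.filter fun M : κ → κ → Bool => M a₀ b₀ = true),
        {ω | ∀ a b, ω ∈ triCrossing Ω u' (A a) (A b) ↔ M a b = true} :=
    (BoxMerging_biUnion_stateEvent (fun a b => triCrossing Ω u' (A a) (A b)) a₀ b₀).symm
  rw [e1, e2]
  exact BoxMerging_abs_measureReal_biUnion_sub_le _ _
    (BoxMerging_pairwise_disjoint_stateEvent fun a b => discreteCrossing Ω u (A a) (A b))
    (BoxMerging_pairwise_disjoint_stateEvent fun a b => triCrossing Ω u' (A a) (A b))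
    (BoxMerging_measurableSet_stateEvent _ fun a b => measurableSet_discreteCrossing Ω u (A a) (A b))
    (BoxMerging_measurableSet_stateEvent _ fun a b =>
      BoxMerging_measurableSet_triCrossing hΩ hu' (A a) (A b)) _

/-! ### The square window at resolution `0` -/

/-- The route's window `Sq δ₀ = (0, δ₀)²` is the carrier of the tree's model square
`rectQuad 0 δ₀ 0 δ₀` (corners marked counterclockwise from `0`). [folklore] -/
theorem BoxMerging_sq_eq_rectQuad_carrier {δ₀ : ℝ} (hδ₀ : 0 < δ₀) :
    {z : ℂ | 0 < z.re ∧ z.re < δ₀ ∧ 0 < z.im ∧ z.im < δ₀} = (rectQuad 0 δ₀ 0 δ₀ hδ₀ hδ₀).carrier := by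
  ext z
  rw [mem_rectQuad_carrier]
  simp only [mem_setOf_eq, mem_Ioo]
  tauto

/-- At resolution `j = 0` the route's bottom segment `seg δ₀ 0 (0, ·)` is the bottom side of the
square, i.e. arc `0` of `rectQuad 0 δ₀ 0 δ₀`. [folklore] -/
theorem BoxMerging_seg_zero_eq_arc_zero {δ₀ : ℝ} (hδ₀ : 0 < δ₀) (a : Fin 4 × Fin (2 ^ 0))
    (ha : a.1 = 0) :
    {z : ℂ | (a.1 = 0 ∧ z.im = 0 ∧ δ₀ * ((a.2 : ℕ) : ℝ) / 2 ^ 0 ≤ z.re ∧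
          z.re ≤ δ₀ * (((a.2 : ℕ) : ℝ) + 1) / 2 ^ 0) ∨
        (a.1 = 1 ∧ z.re = δ₀ ∧ δ₀ * ((a.2 : ℕ) : ℝ) / 2 ^ 0 ≤ z.im ∧
          z.im ≤ δ₀ * (((a.2 : ℕ) : ℝ) + 1) / 2 ^ 0) ∨
        (a.1 = 2 ∧ z.im = δ₀ ∧ δ₀ * ((a.2 : ℕ) : ℝ) / 2 ^ 0 ≤ z.re ∧
          z.re ≤ δ₀ * (((a.2 : ℕ) : ℝ) + 1) / 2 ^ 0) ∨
        (a.1 = 3 ∧ z.re = 0 ∧ δ₀ * ((a.2 : ℕ) : ℝ) / 2 ^ 0 ≤ z.im ∧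
          z.im ≤ δ₀ * (((a.2 : ℕ) : ℝ) + 1) / 2 ^ 0)} =
      (rectQuad 0 δ₀ 0 δ₀ hδ₀ hδ₀).arc 0 := by
  have ht : (a.2 : ℕ) = 0 := by have h := a.2.isLt; simp only [pow_zero] at h; omega
  ext z
  rw [mem_rectQuad_arc_zero]
  simp only [mem_setOf_eq, mem_Icc, ht, Nat.cast_zero, mul_zero, zero_add, mul_one,
    pow_zero, div_one]
  constructor
  · rintro (⟨-, h1, h2, h3⟩ | ⟨h1, -⟩ | ⟨h1, -⟩ | ⟨h1, -⟩)
    · exact ⟨h1, h2, h3⟩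
    · rw [ha] at h1; exact absurd h1 (by decide)
    · rw [ha] at h1; exact absurd h1 (by decide)
    · rw [ha] at h1; exact absurd h1 (by decide)
  · rintro ⟨h1, h2, h3⟩
    exact Or.inl ⟨ha, h1, h2, h3⟩

/-- At resolution `j = 0` the route's top segment `seg δ₀ 0 (2, ·)` is the top side of the
square, i.e. arc `2` of `rectQuad 0 δ₀ 0 δ₀`. [folklore] -/
theorem BoxMerging_seg_two_eq_arc_two {δ₀ : ℝ} (hδ₀ : 0 < δ₀) (a : Fin 4 × Fin (2 ^ 0))
    (ha : a.1 = 2) :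
    {z : ℂ | (a.1 = 0 ∧ z.im = 0 ∧ δ₀ * ((a.2 : ℕ) : ℝ) / 2 ^ 0 ≤ z.re ∧
          z.re ≤ δ₀ * (((a.2 : ℕ) : ℝ) + 1) / 2 ^ 0) ∨
        (a.1 = 1 ∧ z.re = δ₀ ∧ δ₀ * ((a.2 : ℕ) : ℝ) / 2 ^ 0 ≤ z.im ∧
          z.im ≤ δ₀ * (((a.2 : ℕ) : ℝ) + 1) / 2 ^ 0) ∨
        (a.1 = 2 ∧ z.im = δ₀ ∧ δ₀ * ((a.2 : ℕ) : ℝ) / 2 ^ 0 ≤ z.re ∧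
          z.re ≤ δ₀ * (((a.2 : ℕ) : ℝ) + 1) / 2 ^ 0) ∨
        (a.1 = 3 ∧ z.re = 0 ∧ δ₀ * ((a.2 : ℕ) : ℝ) / 2 ^ 0 ≤ z.im ∧
          z.im ≤ δ₀ * (((a.2 : ℕ) : ℝ) + 1) / 2 ^ 0)} =
      (rectQuad 0 δ₀ 0 δ₀ hδ₀ hδ₀).arc 2 := by
  have ht : (a.2 : ℕ) = 0 := by have h := a.2.isLt; simp only [pow_zero] at h; omega
  ext z
  rw [mem_rectQuad_arc_two]
  simp only [mem_setOf_eq, mem_Icc, ht, Nat.cast_zero, mul_zero, zero_add, mul_one,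
    pow_zero, div_one]
  constructor
  · rintro (⟨h1, -⟩ | ⟨h1, -⟩ | ⟨-, h1, h2, h3⟩ | ⟨h1, -⟩)
    · rw [ha] at h1; exact absurd h1 (by decide)
    · rw [ha] at h1; exact absurd h1 (by decide)
    · exact ⟨h1, h2, h3⟩
    · rw [ha] at h1; exact absurd h1 (by decide)
  · rintro ⟨h1, h2, h3⟩
    exact Or.inr (Or.inr (Or.inl ⟨ha, h1, h2, h3⟩))

/-! ### `BoxMerging` ⇒ Cardy's formula for the square on `ℤ²` -/

/-- **`BoxMerging` proves Cardy's formula on `ℤ²` for the square.**  If the bond-`ℤ²` and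
site-`𝕋` laws of the boundary-segment connectivity matrix of the square merge (route item
`BoxMerging`, used at resolution `j = 0` only), then bond percolation on `ℤ²` at `p = 1/2` satisfies
Cardy's formula in the conformal rectangle `((0, δ₀)²; 0, δ₀, δ₀ + iδ₀, iδ₀)`: the bottom–top
crossing event of the square is read from the `j = 0` state (`BoxMerging_abs_bond_sub_tri_le`
with `BoxMerging_seg_zero_eq_arc_zero`, `BoxMerging_seg_two_eq_arc_two`), so its `ℤ²` and `𝕋`
probabilities are `2·TV₀`-close, and Smirnov's theorem on `𝕋`
(`hasCrossingLimit_triDomainCrossingProb_holds`) gives the `𝕋`-limit `F(η)`.  The conclusion is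
an instance of the conjunct `CardyFormulaZ2`, not proved in the tree: the node `BoxMerging` is at
least that hard. [folklore] -/
theorem BoxMerging_hasCrossingLimit_square (hBM : BoxMerging) {δ₀ : ℝ} (hδ₀ : 0 < δ₀) :
    (rectQuad 0 δ₀ 0 δ₀ hδ₀ hδ₀).HasCrossingLimit
      (bondDomainCrossingProb (rectQuad 0 δ₀ 0 δ₀ hδ₀ hδ₀))
      Literature.Probability.RandomPlanarGeometry.cardyFunction := by
  set R := rectQuad 0 δ₀ 0 δ₀ hδ₀ hδ₀ with hR
  intro φ x hux
  have htri := hasCrossingLimit_triDomainCrossingProb_holds R φ x hux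
  rw [Metric.tendsto_nhdsWithin_nhds] at htri ⊢
  intro ε hε
  obtain ⟨η, hη, hBM'⟩ := hBM δ₀ hδ₀ 0 (ε / 4) (by positivity)
  obtain ⟨η₃, hη₃, htri'⟩ := htri (ε / 2) (by positivity)
  refine ⟨η, hη, fun u hu hdist => ?_⟩
  rw [mem_Ioi] at hu
  rw [Real.dist_eq, sub_zero, abs_of_pos hu] at hdist
  -- a fixed small `𝕋`-mesh
  set u' : ℝ := min η η₃ / 2 with hu'
  have hm : 0 < min η η₃ := lt_min hη hη₃
  have hu'0 : 0 < u' := by positivity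
  have hu'η : u' < η := by
    have := min_le_left η η₃; rw [hu']; linarith
  have hu'η₃ : u' < η₃ := by
    have := min_le_right η η₃; rw [hu']; linarith
  -- the resolution-0 segments and the window
  set Sq : Set ℂ := {z : ℂ | 0 < z.re ∧ z.re < δ₀ ∧ 0 < z.im ∧ z.im < δ₀} with hSq
  set seg : Fin 4 × Fin (2 ^ 0) → Set ℂ := fun a =>
    {z : ℂ | (a.1 = 0 ∧ z.im = 0 ∧ δ₀ * ((a.2 : ℕ) : ℝ) / 2 ^ 0 ≤ z.re ∧
          z.re ≤ δ₀ * (((a.2 : ℕ) : ℝ) + 1) / 2 ^ 0) ∨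
        (a.1 = 1 ∧ z.re = δ₀ ∧ δ₀ * ((a.2 : ℕ) : ℝ) / 2 ^ 0 ≤ z.im ∧
          z.im ≤ δ₀ * (((a.2 : ℕ) : ℝ) + 1) / 2 ^ 0) ∨
        (a.1 = 2 ∧ z.im = δ₀ ∧ δ₀ * ((a.2 : ℕ) : ℝ) / 2 ^ 0 ≤ z.re ∧
          z.re ≤ δ₀ * (((a.2 : ℕ) : ℝ) + 1) / 2 ^ 0) ∨
        (a.1 = 3 ∧ z.re = 0 ∧ δ₀ * ((a.2 : ℕ) : ℝ) / 2 ^ 0 ≤ z.im ∧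
          z.im ≤ δ₀ * (((a.2 : ℕ) : ℝ) + 1) / 2 ^ 0)} with hseg
  -- `BoxMerging` at resolution 0 and meshes `u, u'`
  have hTV : (1 / 2 : ℝ) * ∑ M : (Fin 4 × Fin (2 ^ 0)) → (Fin 4 × Fin (2 ^ 0)) → Bool,
      |(bondPercolation (zdGraph 2) half).real
          {ω | ∀ a b, ω ∈ discreteCrossing Sq u (seg a) (seg b) ↔ M a b = true} -
        (triSitePercolation half).real
          {ω | ∀ a b, ω ∈ triCrossing Sq u' (seg a) (seg b) ↔ M a b = true}| ≤ ε / 4 :=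
    hBM' u u' hu hdist hu'0 hu'η
  -- the crossing of `R` is read from the state
  set a₀ : Fin 4 × Fin (2 ^ 0) := (0, ⟨0, by norm_num⟩) with ha₀
  set b₀ : Fin 4 × Fin (2 ^ 0) := (2, ⟨0, by norm_num⟩) with hb₀
  have hSqR : Sq = R.carrier := BoxMerging_sq_eq_rectQuad_carrier hδ₀
  have hA : seg a₀ = R.arc 0 := BoxMerging_seg_zero_eq_arc_zero hδ₀ a₀ rfl
  have hB : seg b₀ = R.arc 2 := BoxMerging_seg_two_eq_arc_two hδ₀ b₀ rfl
  have hbdd : Bornology.IsBounded Sq := hSqR ▸ R.isBounded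
  have key := BoxMerging_abs_bond_sub_tri_le hbdd seg a₀ b₀ u hu'0
  rw [hA, hB] at key
  rw [hSqR] at key hTV
  have hZT : |bondDomainCrossingProb R u - triDomainCrossingProb R u'| ≤ ε / 2 := by
    rw [bondDomainCrossingProb_eq_measureReal, triDomainCrossingProb_eq_measureReal]
    linarith
  -- Smirnov on `𝕋` at mesh `u'`
  have hT : dist (triDomainCrossingProb R u')
      (Literature.Probability.RandomPlanarGeometry.cardyFunction (crossRatio x)) < ε / 2 := by
    refine htri' (mem_Ioi.2 hu'0) ?_
    rwa [Real.dist_eq, sub_zero, abs_of_pos hu'0]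
  rw [Real.dist_eq] at hT ⊢
  have := abs_sub_le (bondDomainCrossingProb R u) (triDomainCrossingProb R u')
    (Literature.Probability.RandomPlanarGeometry.cardyFunction (crossRatio x))
  linarith

/-- **`BoxMerging` ⇒ the critical square of `ℤ²` is crossed with probability `→ 1/2`.**  Under
`BoxMerging`, `P_{1/2}[bottom ↔ top in ((0, δ₀)²)_u] → 1/2` as the mesh `u → 0⁺` (G02
discretisation `bondDomainCrossingProb` of `rectQuad 0 δ₀ 0 δ₀`): by
`BoxMerging_hasCrossingLimit_square` the limit is `F(η)` for any uniformizing datum (one exists,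
`MarkedDomain.exists_isUniformizing_holds`), the reflection `z ↦ i z̄` in the diagonal shows
`η = 1/2` (`ConformalRectangle.crossRatio_eq_half_of_antiAffine`), and `F(1/2) = 1/2`
(`cardyFunction_half`).  Folklore for `ℤ²` by self-duality, but not a theorem of the tree.
[folklore] -/
theorem BoxMerging_tendsto_half_square (hBM : BoxMerging) {δ₀ : ℝ} (hδ₀ : 0 < δ₀) :
    Tendsto (bondDomainCrossingProb (rectQuad 0 δ₀ 0 δ₀ hδ₀ hδ₀)) (𝓝[>] 0) (𝓝 (1 / 2)) := by
  set R := rectQuad 0 δ₀ 0 δ₀ hδ₀ hδ₀ with hR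
  obtain ⟨φ, x, hφx⟩ := MarkedDomain.exists_isUniformizing_holds R
  have h := BoxMerging_hasCrossingLimit_square hBM hδ₀ φ x hφx
  obtain ⟨h0, h1, h2, h3⟩ := RectilinearCardy.Negative.rectQuad_pt (hx := hδ₀) (hy := hδ₀)
    (x₀ := 0) (x₁ := δ₀) (y₀ := 0) (y₁ := δ₀)
  have hcr : crossRatio x = 1 / 2 := by
    refine ConformalRectangle.crossRatio_eq_half_of_antiAffine R (u := Complex.I) (v := 0)
      (by simp) (by simp) ?_ ?_ ?_ ?_ hφx
    · intro z hz
      rw [hR, mem_rectQuad_carrier] at hz ⊢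
      simp only [antiAffine_apply, add_zero, Complex.mul_re, Complex.I_re, Complex.conj_re,
        zero_mul, Complex.I_im, Complex.conj_im, one_mul, zero_sub, neg_neg, Complex.mul_im,
        zero_add, mem_Ioo] at hz ⊢
      exact ⟨hz.2, hz.1⟩
    · rw [h0]; apply Complex.ext <;> simp
    · rw [h2]; apply Complex.ext <;> simp
    · rw [h1, h3]; apply Complex.ext <;> simp
  rwa [hcr, RectilinearCardy.Negative.cardyFunction_half] at h

end Summit.CriticalPhenomena.CardyFormulaZ2.Theorems
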